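import Summits.NavierStokesRegularity.NavierStokesRegularity.Theorems.HodographBetchovClassBudgetsRegulariseSlab

/-!
# Crux `HodographBetchov.FastClassSqueeze` — enstrophy Grönwall on a closed slab from a
# slow-class-free ledger

Helper file for the crux item stmt-NavierStokesRegularity-15832 (`FastClassSqueeze`, route
`HodographBetchov` of `NavierStokesRegularity`): the time integration of a per-slice enstrophy
ledger WITHOUT slow-class production term. For a classical solution `(u, p)` on the closed slab
`[0, T] × ℝ³` in Tao's class and a (possibly non-measurable, possibly infinite) charge
`A : ℝ → ℝ≥0∞` with `Λ = ∫₀ᵀ A < ∞`: if at every interior time with `A(t) < ∞`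

  `∫ Σᵢ ⟪∂ᵢu(t), ∂ᵢ∂ₜu(t)⟫ ≤ (a + κ A(t)) ∫ |∇u(t)|²_F`   (`a, κ ≥ 0` constants),

then `∫|∇u(s)|²_F ≤ (∫|∇u(0)|²_F + 1) exp(2aT + (2κ + 1)Λ)` on `[0, T]`
(`enstrophy_gronwall_of_ledger`). Proof as in `ClassBudgetsRegularise.classBudget_enstrophy_slab`
(enstrophy balance `IsSmoothSpaceTimeOn.enstrophy_balance`, the `ℝ≥0∞`-kernel Grönwall lemma
`lintegral_gronwall_le` run for `G + 1`), with the slow budget gone and the constant rate `a` added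
to the kernel. The velocity-truncated ledger (`StreamStrain.truncatedLedger_slice`) is of this form.

References: P. G. Lemarié-Rieusset (2016), Thm. 11.2; J. C. Robinson, J. L. Rodrigo, W. Sadowski
(2016), Lemma A.25 (Grönwall).
-/

noncomputable section

open MeasureTheory Set Function Filter Topology InnerProductSpace
open scoped ENNReal NNReal ContDiff RealInnerProductSpace Laplacian

set_option linter.dupNamespace false -- summit and sub-problem share the name (CONVENTIONS §1)

namespace Summit.NavierStokesRegularity.NavierStokesRegularity.Theorems.FastClassSqueeze.StreamStrain

open Literature.Analysis Literature.Analysis.FluidPDE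

/-- **Enstrophy Grönwall on a closed slab from a slow-class-free ledger** (module docstring):
`∫|∇u(s)|²_F ≤ (∫|∇u(0)|²_F + 1) exp(2aT + (2κ+1) Λ)` for `s ∈ [0, T]`. [cite: LemarieRieusset2016, Thm. 11.2 with (11.9)] -/
theorem enstrophy_gronwall_of_ledger {ν T : ℝ} (hT : 0 < T)
    {u : ℝ → EuclideanSpace ℝ (Fin 3) → EuclideanSpace ℝ (Fin 3)}
    {p : ℝ → EuclideanSpace ℝ (Fin 3) → ℝ} (hsol : FluidPDE.IsClassicalNSSolutionOn (Icc 0 T) ν 0 u p)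
    (hu : HasBoundedSobolevNormsOn (Icc 0 T) u)
    (hut : HasBoundedSobolevNormsOn (Icc 0 T) (FluidPDE.timeDerivWithin (Icc 0 T) u))
    {a κ : ℝ} (ha : 0 ≤ a) (hκ : 0 ≤ κ) {A : ℝ → ℝ≥0∞} (hΛ : ∫⁻ t in Ioo 0 T, A t ≠ ⊤)
    (hled : ∀ t ∈ Ioo 0 T, A t ≠ ⊤ →
      ∫ x, ∑ i, ⟪fderiv ℝ (u t) x (EuclideanSpace.basisFun (Fin 3) ℝ i),
          fderiv ℝ (FluidPDE.timeDerivWithin (Icc 0 T) u t) x (EuclideanSpace.basisFun (Fin 3) ℝ i)⟫ ≤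
        (a + κ * (A t).toReal) * ∫ x, frobeniusNormSq (fderiv ℝ (u t) x)) :
    ∀ s ∈ Icc 0 T, ∫ x, frobeniusNormSq (fderiv ℝ (u s) x) ≤
      ((∫ x, frobeniusNormSq (fderiv ℝ (u 0) x)) + 1) *
        Real.exp (2 * a * T + (2 * κ + 1) * (∫⁻ t in Ioo 0 T, A t).toReal) := by
  set e := EuclideanSpace.basisFun (Fin 3) ℝ with he
  set W : ℝ → EuclideanSpace ℝ (Fin 3) → EuclideanSpace ℝ (Fin 3) :=
    FluidPDE.timeDerivWithin (Icc 0 T) u with hW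
  obtain ⟨C₁, hC₁⟩ := hu 1
  obtain ⟨E₁, hE₁⟩ := hut 1
  -- the enstrophy balance
  obtain ⟨hΦint, -, hGb⟩ := hsol.smooth_velocity.enstrophy_balance hT hC₁ hE₁
  set Φ : ℝ → ℝ := fun t => ∫ x, 2 * ∑ i, ⟪fderiv ℝ (u t) x (e i), fderiv ℝ (W t) x (e i)⟫ with hΦ
  set G : ℝ → ℝ := fun t => ∫ x, FluidPDE.frobeniusNormSq (fderiv ℝ (u t) x) with hG
  have hG0 : ∀ t, 0 ≤ G t := fun t => integral_nonneg fun x => FluidPDE.frobeniusNormSq_nonneg _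
  have hfrob_le : ∀ t ∈ Icc 0 T,
      ∫⁻ x, ENNReal.ofReal (FluidPDE.frobeniusNormSq (fderiv ℝ (u t) x)) ≤ 3 * C₁ := by
    intro t ht
    calc ∫⁻ x, ENNReal.ofReal (FluidPDE.frobeniusNormSq (fderiv ℝ (u t) x))
        ≤ ∫⁻ x, 3 * ‖iteratedFDeriv ℝ 1 (u t) x‖ₑ ^ 2 := lintegral_mono fun x => by
          rw [← ofReal_norm, norm_iteratedFDeriv_one, ofReal_norm]
          exact ofReal_frobeniusNormSq_le_three_mul_enorm_sq _
      _ = 3 * ∫⁻ x, ‖iteratedFDeriv ℝ 1 (u t) x‖ₑ ^ 2 := lintegral_const_mul' _ _ (by norm_num)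
      _ ≤ 3 * C₁ := by gcongr; exact hC₁ t ht
  have hfrob_lt : ∀ t ∈ Icc 0 T,
      ∫⁻ x, ENNReal.ofReal (FluidPDE.frobeniusNormSq (fderiv ℝ (u t) x)) < ⊤ := fun t ht =>
    lt_of_le_of_lt (hfrob_le t ht) (ENNReal.mul_lt_top (by norm_num) ENNReal.coe_lt_top)
  have ifrob : ∀ t ∈ Icc 0 T, Integrable (fun x => FluidPDE.frobeniusNormSq (fderiv ℝ (u t) x)) volume :=
    fun t ht => integrable_of_continuous_of_nonneg
      (FluidPDE.continuous_frobeniusNormSq_fderiv (hsol.contDiff_velocity ht) (by simp))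
      (fun x => FluidPDE.frobeniusNormSq_nonneg _) (hfrob_lt t ht)
  have hGeq : ∀ t ∈ Icc 0 T, ENNReal.ofReal (G t) =
      ∫⁻ x, ENNReal.ofReal (FluidPDE.frobeniusNormSq (fderiv ℝ (u t) x)) := fun t ht =>
    ofReal_integral_eq_lintegral_ofReal (ifrob t ht)
      (Eventually.of_forall fun x => FluidPDE.frobeniusNormSq_nonneg _)
  -- the kernel `aE(t) = 2a + (2κ + 1) A(t)`
  set aE : ℝ → ℝ≥0∞ := fun t => ENNReal.ofReal (2 * a) + ENNReal.ofReal (2 * κ + 1) * A t with haE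
  -- the ledger at interior times: `ofReal (Φ t) ≤ aE t * ofReal (G t + 1)`
  have hslice : ∀ t ∈ Ioo 0 T, ENNReal.ofReal (Φ t) ≤ aE t * ENNReal.ofReal (G t + 1) := by
    intro t ht
    by_cases hfin : A t = ⊤
    · have hκpos : 0 < 2 * κ + 1 := by linarith
      have h1 : aE t = ⊤ := by
        rw [haE]; simp only
        rw [hfin, ENNReal.mul_top (by simpa using hκpos)]
        simp
      rw [h1, ENNReal.top_mul (by have := hG0 t; simp; linarith)]
      exact le_top
    · have h3 := hled t ht hfin
      have h2 : Φ t = 2 * ∫ x, ∑ i, ⟪fderiv ℝ (u t) x (e i), fderiv ℝ (W t) x (e i)⟫ := by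
        rw [hΦ]; exact integral_const_mul _ _
      have hA0 : 0 ≤ (A t).toReal := ENNReal.toReal_nonneg
      have hreal : Φ t ≤ (2 * a + (2 * κ + 1) * (A t).toReal) * (G t + 1) := by
        rw [h2]
        have hG' : (∫ x, FluidPDE.frobeniusNormSq (fderiv ℝ (u t) x)) = G t := rfl
        rw [hG'] at h3
        nlinarith [h3, hG0 t, mul_nonneg hκ hA0, mul_nonneg (mul_nonneg hκ hA0) (hG0 t), ha, hA0,
          mul_nonneg hA0 (hG0 t)]
      calc ENNReal.ofReal (Φ t) ≤ ENNReal.ofReal ((2 * a + (2 * κ + 1) * (A t).toReal) * (G t + 1)) :=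
            ENNReal.ofReal_le_ofReal hreal
        _ = aE t * ENNReal.ofReal (G t + 1) := by
            rw [haE]; simp only
            have h2κ : 0 ≤ 2 * κ + 1 := by linarith
            rw [ENNReal.ofReal_mul (by positivity), ENNReal.ofReal_add (by positivity) (by positivity),
              ENNReal.ofReal_mul h2κ, ENNReal.ofReal_toReal hfin]
  -- Grönwall in `ℝ≥0∞` for `ψ = G + 1`
  set ψE : ℝ → ℝ≥0∞ := fun t => ENNReal.ofReal (G t + 1) with hψE
  have hM : ∀ t ∈ Icc 0 T, ψE t ≤ 3 * C₁ + 1 := fun t ht => by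
    rw [hψE]; simp only
    rw [ENNReal.ofReal_add (hG0 t) zero_le_one, ENNReal.ofReal_one, hGeq t ht]
    exact add_le_add (hfrob_le t ht) le_rfl
  have haT_eq : ∫⁻ t in Ioo 0 T, aE t =
      ENNReal.ofReal (2 * a) * ENNReal.ofReal T + ENNReal.ofReal (2 * κ + 1) * ∫⁻ t in Ioo 0 T, A t := by
    rw [haE]; simp only
    rw [lintegral_add_left' aemeasurable_const, lintegral_const_mul' _ _ ENNReal.ofReal_ne_top,
      setLIntegral_const, Real.volume_Ioo, sub_zero]
  have haT : ∫⁻ t in Ioo 0 T, aE t ≠ ⊤ := by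
    rw [haT_eq]
    exact ENNReal.add_ne_top.2 ⟨ENNReal.mul_ne_top ENNReal.ofReal_ne_top ENNReal.ofReal_ne_top,
      ENNReal.mul_ne_top ENNReal.ofReal_ne_top hΛ⟩
  set Bc : ℝ := G 0 + 1 with hBc
  have hBc0 : 0 ≤ Bc := by have := hG0 0; positivity
  have hineq : ∀ t ∈ Icc 0 T, ψE t ≤ ENNReal.ofReal Bc + ∫⁻ τ in Ioo 0 t, aE τ * ψE τ := by
    intro t ht
    rcases eq_or_lt_of_le ht.1 with h0 | ht0
    · rw [← h0, hψE, hBc]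
      exact le_self_add
    have htT : t ∈ Ioc 0 T := ⟨ht0, ht.2⟩
    have hΦt : IntegrableOn Φ (Ioo 0 t) volume := hΦint.mono_set (Ioo_subset_Ioo le_rfl ht.2)
    have h1 : ENNReal.ofReal (∫ τ in Ioo 0 t, Φ τ) ≤ ∫⁻ τ in Ioo 0 t, ENNReal.ofReal (Φ τ) := by
      calc ENNReal.ofReal (∫ τ in Ioo 0 t, Φ τ)
          ≤ ENNReal.ofReal (∫ τ in Ioo 0 t, max (Φ τ) 0) :=
            ENNReal.ofReal_le_ofReal (integral_mono hΦt hΦt.pos_part fun τ => le_max_left _ _)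
        _ = ∫⁻ τ in Ioo 0 t, ENNReal.ofReal (max (Φ τ) 0) :=
            ofReal_integral_eq_lintegral_ofReal hΦt.pos_part (Eventually.of_forall fun τ => le_max_right _ _)
        _ = ∫⁻ τ in Ioo 0 t, ENNReal.ofReal (Φ τ) := lintegral_congr fun τ => by
            rcases le_total (Φ τ) 0 with h | h
            · rw [max_eq_right h, ENNReal.ofReal_zero, ENNReal.ofReal_of_nonpos h]
            · rw [max_eq_left h]
    have h2 : ∫⁻ τ in Ioo 0 t, ENNReal.ofReal (Φ τ) ≤ ∫⁻ τ in Ioo 0 t, aE τ * ψE τ :=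
      setLIntegral_mono' measurableSet_Ioo fun τ hτ => hslice τ ⟨hτ.1, hτ.2.trans_le ht.2⟩
    have hGt : G t = G 0 + ∫ τ in Ioo 0 t, Φ τ := by
      have h := hGb t htT
      rw [intervalIntegral.integral_of_le ht.1, integral_Ioc_eq_integral_Ioo] at h
      exact h
    calc ψE t = ENNReal.ofReal (G 0 + 1 + ∫ τ in Ioo 0 t, Φ τ) := by
          rw [hψE]; simp only
          rw [hGt]
          congr 1; ring
      _ ≤ ENNReal.ofReal Bc + ENNReal.ofReal (∫ τ in Ioo 0 t, Φ τ) := by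
          rw [hBc]; exact ENNReal.ofReal_add_le
      _ ≤ ENNReal.ofReal Bc + ∫⁻ τ in Ioo 0 t, aE τ * ψE τ := by gcongr; exact h1.trans h2
  have hgron := lintegral_gronwall_le (S := T) ENNReal.ofReal_ne_top
    (ENNReal.add_ne_top.2 ⟨ENNReal.mul_ne_top (by norm_num) ENNReal.coe_ne_top, ENNReal.one_ne_top⟩)
    hM haT hineq
  -- unpack
  intro s hs
  have hs' := hgron s hs
  have haS : (∫⁻ τ in Ioo 0 s, aE τ) ≤ ∫⁻ τ in Ioo 0 T, aE τ := lintegral_mono_set (Ioo_subset_Ioo le_rfl hs.2)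
  have haS_fin : (∫⁻ τ in Ioo 0 s, aE τ) ≠ ⊤ := ne_top_of_le_ne_top haT haS
  have hint_a : (∫⁻ τ in Ioo 0 T, aE τ).toReal = 2 * a * T + (2 * κ + 1) * (∫⁻ t in Ioo 0 T, A t).toReal := by
    rw [haT_eq, ENNReal.toReal_add (ENNReal.mul_ne_top ENNReal.ofReal_ne_top ENNReal.ofReal_ne_top)
      (ENNReal.mul_ne_top ENNReal.ofReal_ne_top hΛ), ENNReal.toReal_mul, ENNReal.toReal_mul,
      ENNReal.toReal_ofReal (by positivity), ENNReal.toReal_ofReal hT.le,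
      ENNReal.toReal_ofReal (by positivity)]
  have hexp_le : Real.exp ((∫⁻ τ in Ioo 0 s, aE τ).toReal) ≤
      Real.exp (2 * a * T + (2 * κ + 1) * (∫⁻ t in Ioo 0 T, A t).toReal) := by
    rw [← hint_a]
    exact Real.exp_le_exp.2 (ENNReal.toReal_mono haT haS)
  have hfin : ENNReal.ofReal Bc * ENNReal.ofReal (Real.exp ((∫⁻ τ in Ioo 0 s, aE τ).toReal)) ≠ ⊤ :=
    ENNReal.mul_ne_top ENNReal.ofReal_ne_top ENNReal.ofReal_ne_top
  have hreal : G s + 1 ≤ Bc * Real.exp ((∫⁻ τ in Ioo 0 s, aE τ).toReal) := by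
    have h := (ENNReal.ofReal_le_iff_le_toReal hfin).1 hs'
    rwa [ENNReal.toReal_mul, ENNReal.toReal_ofReal hBc0, ENNReal.toReal_ofReal (Real.exp_nonneg _)] at h
  calc G s ≤ G s + 1 := by linarith
    _ ≤ Bc * Real.exp ((∫⁻ τ in Ioo 0 s, aE τ).toReal) := hreal
    _ ≤ Bc * Real.exp (2 * a * T + (2 * κ + 1) * (∫⁻ t in Ioo 0 T, A t).toReal) :=
        mul_le_mul_of_nonneg_left hexp_le hBc0

/-- **Enstrophy Grönwall from a slow-class-free ledger, registered helper-stub form** (the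
`∀`-closed statement of `enstrophy_gronwall_of_ledger`). [cite: LemarieRieusset2016, Thm. 11.2 with (11.9)] -/
theorem enstrophy_gronwall_of_ledger' :
    ∀ (ν T : ℝ), 0 < T → ∀ (u : ℝ → EuclideanSpace ℝ (Fin 3) → EuclideanSpace ℝ (Fin 3))
      (p : ℝ → EuclideanSpace ℝ (Fin 3) → ℝ),
      Literature.Analysis.FluidPDE.IsClassicalNSSolutionOn (Set.Icc 0 T) ν 0 u p →
      Literature.Analysis.FluidPDE.HasBoundedSobolevNormsOn (Set.Icc 0 T) u →
      Literature.Analysis.FluidPDE.HasBoundedSobolevNormsOn (Set.Icc 0 T)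
        (Literature.Analysis.FluidPDE.timeDerivWithin (Set.Icc 0 T) u) →
      ∀ (a κ : ℝ), 0 ≤ a → 0 ≤ κ → ∀ (A : ℝ → ℝ≥0∞), (∫⁻ t in Set.Ioo 0 T, A t ≠ ⊤) →
      (∀ t ∈ Set.Ioo 0 T, A t ≠ ⊤ →
        ∫ x, ∑ i, inner ℝ (fderiv ℝ (u t) x (EuclideanSpace.basisFun (Fin 3) ℝ i))
            (fderiv ℝ (Literature.Analysis.FluidPDE.timeDerivWithin (Set.Icc 0 T) u t) x
              (EuclideanSpace.basisFun (Fin 3) ℝ i)) ≤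
          (a + κ * (A t).toReal) * ∫ x, Literature.Analysis.FluidPDE.frobeniusNormSq (fderiv ℝ (u t) x)) →
      ∀ s ∈ Set.Icc 0 T, ∫ x, Literature.Analysis.FluidPDE.frobeniusNormSq (fderiv ℝ (u s) x) ≤
        ((∫ x, Literature.Analysis.FluidPDE.frobeniusNormSq (fderiv ℝ (u 0) x)) + 1) *
          Real.exp (2 * a * T + (2 * κ + 1) * (∫⁻ t in Set.Ioo 0 T, A t).toReal) := by
  intro ν T hT u p hsol hu hut a κ ha hκ A hΛ hled
  exact enstrophy_gronwall_of_ledger hT hsol hu hut ha hκ hΛ hled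

end Summit.NavierStokesRegularity.NavierStokesRegularity.Theorems.FastClassSqueeze.StreamStrain

end
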